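import Mathlib
import HarnessLib
import Summits.NavierStokesRegularity.NavierStokesRegularity.Theorems.RellichScarScarRigidityApexRegularity
import Summits.NavierStokesRegularity.NavierStokesRegularity.Theorems.RellichScarSymmetricScarExistsApexScaleInvariantBounds
import Summits.NavierStokesRegularity.NavierStokesRegularity.Theorems.AdaptedFrequencyTangentFlowTransferAncientPressure
import Summits.NavierStokesRegularity.NavierStokesRegularity.Theorems.PoloidalWindowDoorPoloidalWindowRigidityWindow

/-!
# Door family (S13–S20), class tools — SCALE-INVARIANT DERIVATIVE AND PRESSURE DECAY OF DOOR-CLASS PROFILES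
# (discharging nsreg-p1's R19 binder `HasTypeIDerivDecay` for door S20 «ChiralWindowDoor» from the tree)

The door class of nsreg-p1's local Type-I doors (S13 `LocalSineTubeDoor` … S19 `LocalTiltingFreeDoor`, S20
«ChiralWindowDoor» in PREP, `HOME/ns-regularity-ideate-p1/r19/R19-PREP.md`, `r19/Sketch20v3.lean`): Type-I time rate
`C`, Type-I SPACE–TIME decay `D` about the apex, continuity on the open backward slab, unit-viscosity Oseen–Duhamel
identity, divergence-free slices.  R19-PREP §B0 adds a BINDER `HasTypeIDerivDecay K v`
(`(‖x‖+√(−t))²‖∇v‖ ≤ K`, `(‖x‖+√(−t))³‖∇²v‖ ≤ K`, `(‖x‖+√(−t))³‖∂ₜv‖ ≤ K`) and lists space–time derivative decay as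
«NOT IN TREE».  It IS in the tree — assembled here, so S20's K2 may drop the binder:

* `apexScaleInvariantBounds` — **the text of the RellichScar line stub `stub_apexScaleInvariantBounds`
  (`Cruxes/SymmetricScarExists/Lines/logtime-bernoulli-certificate.lean`, verbatim), PROVED**: a classical solution on
  `(−∞,0)` with `‖v‖ ≤ C/(‖x‖+√(−t))` is classical with its Riesz pressure `Q[v]`, which with ONE constant obeys the six
  scale-invariant bounds on `∇v, ∇²v, q′, ∇q′, ∂ₜv, ∇∂ₜv` — the tree's conditional form
  `…LogtimeBernoulli.stub_apexScaleInvariantBounds_ofRieszSmooth` composed with the joint smoothness of the Riesz pressure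
  `…RellichScarScarRigidity.isSmoothSpaceTimeOn_rieszPressure` landed later by the ScarRigidity lane (KNSS 2009 Prop. 4.1
  / Thm 6.1 time-derivative decay); nobody had written the one-line composition;
* `exists_classical_scaleInvariantBounds_of_class` — a door-class profile is classical on `(−∞,0)` for its Riesz pressure
  with the ALL-ORDERS package `ScaleInvariantBounds` (`‖∇ⁿv‖ ≤ L/(·)^(1+n)`, `‖∇ⁿQ‖ ≤ L/(·)^(2+n)`,
  `‖∂ₜ∇ⁿv‖ ≤ L/(·)^(3+n)`; `isTypeIAncientMild_of_class` + `exists_isClassicalNSSolutionOn_Iio_of_isTypeIAncientMild` +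
  `scaleInvariantBounds_rieszPressure`);
* `derivDecay_of_class` — **the body of R19's `HasTypeIDerivDecay K v` from the door class alone** (text of
  `r19/Sketch20v3.lean` l.63, with `∃ K`); `pressureDecay_of_class` — a classical pressure with
  `(·)²|q′| ≤ K`, `(·)³‖∇q′‖ ≤ K` (what B3's helicity-flux bookkeeping needs).

Seat nsreg-p6 g10 (THEOREMS-ONLY door sequels, DIRECTOR-NS g8 #32 (2)/#36).  WHAT THIS IS NOT: not NS regularity; not
a statement about S20's cruxes — plumbing from the RellichScar / Pineau–Vicol toolkit to the door class; no route is
opened.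
-/

noncomputable section

-- the summit and its single sub-problem share the name (CONVENTIONS §1), as in every Theorems file
set_option linter.dupNamespace false

namespace Summit.NavierStokesRegularity.NavierStokesRegularity.Theorems.ChiralWindowDoorClassDerivDecay

open Set Function Filter Topology Metric
open scoped RealInnerProductSpace InnerProductSpace
open Literature.Analysis Literature.Analysis.FluidPDE
open Summit.NavierStokesRegularity.NavierStokesRegularity.Theorems.PoloidalWindowDoorPoloidalWindowRigidityWindow (isTypeIAncientMild_of_class)
open Summit.NavierStokesRegularity.NavierStokesRegularity.Theorems.RellichScarScarRigidity (isSmoothSpaceTimeOn_rieszPressure isClassicalNSSolutionOn_rieszPressure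
  scaleInvariantBounds_rieszPressure)
open Summit.NavierStokesRegularity.NavierStokesRegularity.Theorems.SymmetricScarExists.LogtimeBernoulli (stub_apexScaleInvariantBounds_ofRieszSmooth)

variable {C D : ℝ} {v : ℝ → EuclideanSpace ℝ (Fin 3) → EuclideanSpace ℝ (Fin 3)}

/-- **`stub_apexScaleInvariantBounds` of the RellichScar line `logtime-bernoulli-certificate` (crux `SymmetricScarExists`,
text verbatim), PROVED**: a classical Type-I solution on the past is classical with SOME pressure obeying the six
scale-invariant bounds (`∇v, ∇²v, q′, ∇q′, ∂ₜv, ∇∂ₜv` with powers `2,3,2,3,3,4`). -/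
theorem apexScaleInvariantBounds :
    ∀ (v : ℝ → EuclideanSpace ℝ (Fin 3) → EuclideanSpace ℝ (Fin 3)) (q : ℝ → EuclideanSpace ℝ (Fin 3) → ℝ) (C : ℝ), Literature.Analysis.FluidPDE.IsClassicalNSSolutionOn (Set.Iio 0) 1 0 v q → Literature.Analysis.FluidPDE.HasTypeIDecay C v → ∃ (q' : ℝ → EuclideanSpace ℝ (Fin 3) → ℝ) (K : ℝ), Literature.Analysis.FluidPDE.IsClassicalNSSolutionOn (Set.Iio 0) 1 0 v q' ∧ ∀ t < (0 : ℝ), ∀ (x : EuclideanSpace ℝ (Fin 3)), (‖x‖ + Real.sqrt (-t)) ^ 2 * ‖fderiv ℝ (v t) x‖ ≤ K ∧ (‖x‖ + Real.sqrt (-t)) ^ 3 * ‖iteratedFDeriv ℝ 2 (v t) x‖ ≤ K ∧ (‖x‖ + Real.sqrt (-t)) ^ 2 * |q' t x| ≤ K ∧ (‖x‖ + Real.sqrt (-t)) ^ 3 * ‖gradient (q' t) x‖ ≤ K ∧ (‖x‖ + Real.sqrt (-t)) ^ 3 * ‖Literature.Analysis.FluidPDE.timeDeriv v t x‖ ≤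 K ∧ (‖x‖ + Real.sqrt (-t)) ^ 4 * ‖fderiv ℝ (Literature.Analysis.FluidPDE.timeDeriv v t) x‖ ≤ K :=
  stub_apexScaleInvariantBounds_ofRieszSmooth fun _ _ _ hsol hdec => isSmoothSpaceTimeOn_rieszPressure hsol hdec

/-- **A door-class profile is classical on `(−∞,0)` with its Riesz pressure and the all-orders scale-invariant
package.** -/
theorem exists_classical_scaleInvariantBounds_of_class (hrate : HasTypeITimeDecay C v) (hdec : HasTypeIDecay D v)
    (hcont : ContinuousOn (uncurry v) (Iio (0 : ℝ) ×ˢ univ))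
    (hmild : ∀ s t : ℝ, s < t → t < 0 → ∀ x,
      v t x = UnboundedOperators.heatExtension (v s) (t - s) x - oseenDuhamel 1 s v v t x)
    (hdiv : ∀ t < 0, VectorCalculus.IsDivFree (v t)) :
    ∃ Q : ℝ → EuclideanSpace ℝ (Fin 3) → ℝ, IsClassicalNSSolutionOn (Iio (0 : ℝ)) 1 0 v Q ∧
      Summit.NavierStokesRegularity.NavierStokesRegularity.Theorems.RellichScarScarRigidity.ScaleInvariantBounds v Q := by
  have hA : IsTypeIAncientMild C v := isTypeIAncientMild_of_class hrate hcont hmild hdiv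
  obtain ⟨q, hsol⟩ := exists_isClassicalNSSolutionOn_Iio_of_isTypeIAncientMild hA
  exact ⟨fun t x => pressurePotential (v t) x, isClassicalNSSolutionOn_rieszPressure hsol hdec,
    scaleInvariantBounds_rieszPressure hsol hdec⟩

/-- **A door-class profile is classical on `(−∞,0)`** (some jointly smooth pressure). -/
theorem exists_classical_of_class (hrate : HasTypeITimeDecay C v)
    (hcont : ContinuousOn (uncurry v) (Iio (0 : ℝ) ×ˢ univ))
    (hmild : ∀ s t : ℝ, s < t → t < 0 → ∀ x,
      v t x = UnboundedOperators.heatExtension (v s) (t - s) x - oseenDuhamel 1 s v v t x)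
    (hdiv : ∀ t < 0, VectorCalculus.IsDivFree (v t)) :
    ∃ q : ℝ → EuclideanSpace ℝ (Fin 3) → ℝ, IsClassicalNSSolutionOn (Iio (0 : ℝ)) 1 0 v q :=
  exists_isClassicalNSSolutionOn_Iio_of_isTypeIAncientMild (isTypeIAncientMild_of_class hrate hcont hmild hdiv)

/-- **R19's binder from the class**: `∃ K, HasTypeIDerivDecay K v` (body of nsreg-p1 `r19/Sketch20v3.lean`
`HasTypeIDerivDecay`, verbatim under `∃ K`) for every door-class profile — from `apexScaleInvariantBounds` applied to a
classical pressure of the profile. -/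
theorem derivDecay_of_class :
    ∀ (C D : ℝ) (v : ℝ → EuclideanSpace ℝ (Fin 3) → EuclideanSpace ℝ (Fin 3)), Literature.Analysis.FluidPDE.HasTypeITimeDecay C v → Literature.Analysis.FluidPDE.HasTypeIDecay D v → ContinuousOn (Function.uncurry v) (Set.Iio (0 : ℝ) ×ˢ Set.univ) → (∀ s t : ℝ, s < t → t < 0 → ∀ x, v t x = Literature.Analysis.UnboundedOperators.heatExtension (v s) (t - s) x - Literature.Analysis.FluidPDE.oseenDuhamel 1 s v v t x) → (∀ t < 0, Literature.Analysis.FluidPDE.VectorCalculus.IsDivFree (v t)) → ∃ K : ℝ, ∀ t < (0 : ℝ), ∀ x, (‖x‖ + Real.sqrt (-t)) ^ 2 * ‖fderiv ℝ (v t) x‖ ≤ K ∧ (‖x‖ + Real.sqrt (-t)) ^ 3 * ‖iteratedFDeriv ℝ 2 (v t) x‖ ≤ K ∧ (‖x‖ + Real.sqrt (-t)) ^ 3 * ‖deriv (fun τ => v τ x) t‖ ≤ K := by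
  intro C D v hrate hdec hcont hmild hdiv
  obtain ⟨q, hsol⟩ := exists_classical_of_class hrate hcont hmild hdiv
  obtain ⟨q', K, -, hK⟩ := apexScaleInvariantBounds v q D hsol hdec
  refine ⟨K, fun t ht x => ?_⟩
  obtain ⟨h1, h2, -, -, h5, -⟩ := hK t ht x
  exact ⟨h1, h2, h5⟩

/-- **A decaying classical pressure for a door-class profile**: `(‖x‖+√(−t))²|q′| ≤ K` and `(‖x‖+√(−t))³‖∇q′‖ ≤ K`
(together with the velocity bounds of `derivDecay_of_class`, one constant). -/
theorem pressureDecay_of_class :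
    ∀ (C D : ℝ) (v : ℝ → EuclideanSpace ℝ (Fin 3) → EuclideanSpace ℝ (Fin 3)), Literature.Analysis.FluidPDE.HasTypeITimeDecay C v → Literature.Analysis.FluidPDE.HasTypeIDecay D v → ContinuousOn (Function.uncurry v) (Set.Iio (0 : ℝ) ×ˢ Set.univ) → (∀ s t : ℝ, s < t → t < 0 → ∀ x, v t x = Literature.Analysis.UnboundedOperators.heatExtension (v s) (t - s) x - Literature.Analysis.FluidPDE.oseenDuhamel 1 s v v t x) → (∀ t < 0, Literature.Analysis.FluidPDE.VectorCalculus.IsDivFree (v t)) → ∃ (q' : ℝ → EuclideanSpace ℝ (Fin 3) → ℝ) (K : ℝ), Literature.Analysis.FluidPDE.IsClassicalNSSolutionOn (Set.Iio 0) 1 0 v q' ∧ ∀ t < (0 : ℝ), ∀ (x : EuclideanSpace ℝ (Fin 3)), (‖x‖ + Real.sqrt (-t)) ^ 2 * |q' t x| ≤ K ∧ (‖x‖ + Real.sqrt (-t)) ^ 3 * ‖gradient (q' t) x‖ ≤ K ∧ (‖x‖ + Real.sqrt (-t)) ^ 2 * ‖fderiv ℝ (v t) x‖ ≤ K ∧ (‖x‖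 + Real.sqrt (-t)) ^ 3 * ‖iteratedFDeriv ℝ 2 (v t) x‖ ≤ K ∧ (‖x‖ + Real.sqrt (-t)) ^ 3 * ‖deriv (fun τ => v τ x) t‖ ≤ K := by
  intro C D v hrate hdec hcont hmild hdiv
  obtain ⟨q, hsol⟩ := exists_classical_of_class hrate hcont hmild hdiv
  obtain ⟨q', K, hsol', hK⟩ := apexScaleInvariantBounds v q D hsol hdec
  refine ⟨q', K, hsol', fun t ht x => ?_⟩
  obtain ⟨h1, h2, h3, h4, h5, -⟩ := hK t ht x
  exact ⟨h3, h4, h1, h2, h5⟩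

end Summit.NavierStokesRegularity.NavierStokesRegularity.Theorems.ChiralWindowDoorClassDerivDecay

end
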